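import Summits.BirchSwinnertonDyer.Rank1Residual.Partition.EisensteinKernelDiscriminant
import Literature.NumberTheory.EllipticCurves.RationalTwoTorsionSemistableModPIrreducibleProofs
import Literature.NumberTheory.GaloisRepresentations.KummerQuadraticCharacterInertia
import Literature.NumberTheory.GaloisRepresentations.RatPlaceTwoProofs
import Summits.BirchSwinnertonDyer.Rank1Residual.X2.TwistParityStability
import HarnessLib

/-!
# The Greenberg–Vatsal type of an Eisenstein pair at `p = 3` read off its KERNEL DISCRIMINANT `D`:
# unramified iff `3 ∤ D`, even iff `D > 0`, so `GVPar W 3 ↔ (0 < D ↔ 3 ∣ D)`; and `E^{(D)}` has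
# a rational point of order `3`

HONEST FRAMING (cell `b2b-bsdres-*`, verbatim): the goal of the cell is to DELETE the
COMBINATION-SHAPED residual classes for ALL analytic-rank ≤ 1 curves over ℚ — "full BSD formula
for every rank ≤ 1 curve in class C" assembled STRICTLY from published theorems — so that the
rank-≤1 remainder becomes exactly the CONSTRUCTION-SHAPED classes, which are TYPED (missing-input
Props), NOT attempted; this is not "finishing BSD". Off-peak literature typer `b2b-bsdres-lit-cgls`
(CGLS22 / GV00, the reducible = Eisenstein column), session 11: an ELEMENTARY REDUCTION of the
Eisenstein column at `p = 3` (classes X1@3, X2@3 = 95 % of the reducible census cells), theorems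
only — no definition, no named fact, nothing booked, no label changed.

This is file 3 of 3 (`EisensteinKernelCharacter` → `EisensteinKernelDiscriminant` →
`EisensteinKernelDiscriminantType`). With `Φ ≤ E[p]` a quadratic rational line (every rational
line at `p = 3`) and `D` its kernel discriminant (file 2, property `hχ`), all [folklore]:

* `lineUnramifiedAt_iff_not_dvd` — `Φ` is unramified at `p` iff `p ∤ D` (`⇐` x1a's
  `smul_geomSqrt_eq_of_mem_inertia`; `⇒` for squarefree `D`, `p ∣ D`, an inertia element above
  `p` negates `√D`: the tree's Kummer lemma `exists_mem_inertia_smul_geomSqrt_eq_neg`, `v_p(D) = 1`);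
* `gvType_iff` — the line is of GV type ((ramified ∧ even) ∨ (unramified ∧ odd)) iff
  `(0 < D ↔ p ∣ D)`; hence `gvPar_of_iff` (no reduction hypothesis) and, the type being
  line-independent, `GVPar W p ↔ (0 < D ↔ p ∣ D)` at a good ordinary `p` (`gvPar_iff_of_goodOrd`,
  x1a) and at a multiplicative `p` (`gvPar_iff_of_mult`, lit-cgls s9, granted `hT`, `hT'`);
* `exists_addOrderOf_eq_of_twist` — every model of the twist `E^{(D)}` has a rational point of
  order `p` (sign-equivariant `E^{(D)}[p] ≃ E[p]`, x1a's `exists_signEquiv_of_twist`, + descent);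
* §8 HEADLINES at `p = 3` (no quadratic hypothesis): `exists_kernelDisc_three` (any `E/ℚ` with
  reducible `E[3]`), **`exists_kernelDisc_three_gvPar_iff_of_goodOrd` / `_of_mult`,
  `classX1_three_gvPar_iff` / `classX2_three_gvPar_iff`: `GVPar W 3 ↔ (0 < D ↔ 3 ∣ D)`** — the
  parity type of every X1@3 / X2@3 pair is DECIDED by the sign and the `3`-divisibility of the
  squarefree part `D` of `4x₀³ + b₂x₀² + 2b₄x₀ + b₆` at the abscissa `x₀ ∈ ℚ` of a kernel point:
  type B iff `D ∈ 3ℤ_{>0} ∪ (ℤ_{<0} ∖ 3ℤ)`. Checks: rational `3`-torsion ⇒ `D = 1` ⇒ type A;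
  kernel `μ₃` ⇒ `D = −3` ⇒ type A; odd twist `d < 0`, `3 ∤ d`, of a curve with rational
  `3`-torsion ⇒ `D = d` ⇒ type B (x1a / lit-cgls s9–s10). For the CLASS-CLOSURE `gvpar` column:
  a theory-level determination at `3` — EVIDENCE only; nothing booked.

References: Silverman *AEC* (2009) VIII.§1, X.5.4 [SilvermanAEC2009]; Silverman *ATAEC* (1994)
V.5.3–5.4 (Tate line, via `hT`/`hT'`) [SilvermanATAEC1994]; S. Lang, *Fundamentals of Diophantine
Geometry* (1983) Ch. 6 Prop. 1.3 (Kummer ramification) [Lang1983]; R. Greenberg, V. Vatsal,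
Invent. Math. 142 (2000) [GreenbergVatsal2000]; HOME/b2b-bsdres-lit-cgls/CGLS-GV-TYPING.md §18.
-/

set_option autoImplicit false

noncomputable section

open scoped Classical NumberField

open WeierstrassCurve Literature.NumberTheory.EllipticCurves
  Literature.NumberTheory.EllipticCurves.Rank1Residual Field IsDedekindDomain

namespace Summit.BirchSwinnertonDyer.Rank1Residual

namespace KernelDisc

variable {W : WeierstrassCurve ℚ} {p : ℕ} [Fact p.Prime] {Φ : AddSubgroup (geomTorsion W (p : ℤ))}

/-! ### §5. Ramification of the line at `p` = divisibility of the kernel discriminant by `p` -/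

section Ramification

variable (hp2 : p ≠ 2) {D : ℤ} (hD0 : D ≠ 0)
  (hχ : ∀ σ : absoluteGaloisGroup ℚ, (∀ P ∈ Φ, σ • P = P) ↔ σ • geomSqrt (D : ℚ) = geomSqrt (D : ℚ))

include hχ hp2 in
/-- **`p ∤ D` ⇒ the line is UNRAMIFIED at `p`** (inertia above `p` fixes `√D` when `p ∤ 4D`;
x1a's `smul_geomSqrt_eq_of_mem_inertia`). [folklore] -/
theorem lineUnramifiedAt_of_not_dvd (hpD : ¬ (p : ℤ) ∣ D) : LineUnramifiedAt W p Φ := by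
  intro v hv 𝔓 h𝔓 σ hσ P hP
  have hfix : σ • geomSqrt ((D : ℤ) : ℚ) = geomSqrt ((D : ℤ) : ℚ) :=
    smul_geomSqrt_eq_of_mem_inertia (p := p) (not_dvd_four_mul hp2 hpD) hv h𝔓 hσ
  exact (hχ σ).mpr hfix P hP

/-- `v(r) = 1` from `r ∈ 𝔭 ∖ 𝔭²`. [folklore] -/
theorem intValuation_eq_exp_neg_one_of_mem_of_not_mem_sq {F : Type*} [Field F] [NumberField F]
    (w : HeightOneSpectrum (𝓞 F)) {r : 𝓞 F} (hmem : r ∈ w.asIdeal) (hsq : r ∉ w.asIdeal ^ 2) :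
    w.intValuation r = WithZero.exp (-(1 : ℤ)) := by
  have h1 : w.intValuation r ≤ WithZero.exp (-(1 : ℤ)) := by
    have := (w.intValuation_le_pow_iff_mem r 1).mpr (by rwa [pow_one])
    simpa using this
  have h2 : ¬ w.intValuation r ≤ WithZero.exp (-(2 : ℤ)) := fun h =>
    hsq ((w.intValuation_le_pow_iff_mem r 2).mp (by simpa using h))
  have hr0 : r ≠ 0 := fun h0 => by
    rw [h0] at h2
    exact h2 (by simp)
  rw [w.intValuation_if_neg hr0] at h1 h2 ⊢
  rw [WithZero.exp_le_exp] at h1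
  rw [WithZero.exp_le_exp, not_le] at h2
  congr 1
  omega

/-- For a squarefree integer `D` with `p ∣ D` and the place `v` of `ℚ` above `p`:
`v(D) = 1` (`D ∈ (p) ∖ (p²)` in `𝓞 ℚ ≅ ℤ`). [folklore] -/
theorem intValuation_intCast_eq_exp_neg_one_of_squarefree {D : ℤ} (hsq : Squarefree D)
    (hpD : (p : ℤ) ∣ D) {v : HeightOneSpectrum (𝓞 ℚ)} (hv : (p : 𝓞 ℚ) ∈ v.asIdeal) :
    v.intValuation (D : 𝓞 ℚ) = WithZero.exp (-(1 : ℤ)) := by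
  have hp : p.Prime := Fact.out
  have hspan := Literature.NumberTheory.GaloisRepresentations.Rat.asIdeal_eq_span_of_prime_mem v hp hv
  apply intValuation_eq_exp_neg_one_of_mem_of_not_mem_sq
  · obtain ⟨k, hk⟩ := hpD
    rw [hk, Int.cast_mul, Int.cast_natCast]
    exact v.asIdeal.mul_mem_right _ hv
  · rw [hspan, Ideal.span_singleton_pow, Ideal.mem_span_singleton']
    rintro ⟨a, ha⟩
    -- transport `a * p² = D` to `ℤ`
    have hZ := congrArg (Rat.ringOfIntegersEquiv : 𝓞 ℚ ≃+* ℤ) ha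
    rw [map_mul, map_pow, map_natCast, map_intCast] at hZ
    simp only [Int.cast_id] at hZ
    have hdvd : (p : ℤ) * p ∣ D := ⟨Rat.ringOfIntegersEquiv a, by rw [← hZ]; ring⟩
    have hunit : IsUnit (p : ℤ) := hsq (p : ℤ) hdvd
    rw [Int.isUnit_iff] at hunit
    have := hp.two_le
    omega

include hχ in
/-- **`p ∣ D` (squarefree) ⇒ the line is RAMIFIED at `p`**: some element of an inertia group
above `p` negates `√D` (the Kummer character of a uniformizer is onto `μ₂` on inertia —
`GaloisRepresentations.exists_mem_inertia_smul_geomSqrt_eq_neg`), hence moves every non-zero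
point of `Φ`. [folklore] -/
theorem not_lineUnramifiedAt_of_dvd (hp2 : p ≠ 2) (hD0 : D ≠ 0)
    (hsq : Squarefree D) (hpD : (p : ℤ) ∣ D) : ¬ LineUnramifiedAt W p Φ := by
  have hp : p.Prime := Fact.out
  intro hunr
  obtain ⟨v, hv⟩ :=
    Literature.NumberTheory.NumberFields.RingOfIntegers.exists_heightOneSpectrum_natCast_mem ℚ hp
  obtain ⟨𝔓, h𝔓⟩ := HeightOneSpectrum.primesAbove_nonempty v
  have hval := intValuation_intCast_eq_exp_neg_one_of_squarefree (p := p) hsq hpD hv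
  have h2 : (2 : 𝓞 ℚ) ∉ v.asIdeal :=
    Literature.NumberTheory.GaloisRepresentations.two_not_mem_of_natCast_prime_mem hp hp2 hv
  obtain ⟨σ, hσ, hneg⟩ :=
    Literature.NumberTheory.GaloisRepresentations.exists_mem_inertia_smul_geomSqrt_eq_neg hval h2 h𝔓
  have hcast : ((D : 𝓞 ℚ) : ℚ) = (D : ℚ) := by simp
  rw [hcast] at hneg
  -- `σ` fixes `Φ` pointwise (unramified) hence fixes `√D`: contradiction
  have hfix : σ • geomSqrt (D : ℚ) = geomSqrt (D : ℚ) := (hχ σ).mp (hunr v hv 𝔓 h𝔓 σ hσ)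
  rw [hfix] at hneg
  exact geomSqrt_ne_neg (by exact_mod_cast hD0 : (D : ℚ) ≠ 0) hneg

include hp2 hD0 hχ in
/-- **The line is unramified at `p` iff `p ∤ D`** (for the squarefree kernel discriminant `D`).
[folklore] -/
theorem lineUnramifiedAt_iff_not_dvd (hsq : Squarefree D) : LineUnramifiedAt W p Φ ↔ ¬ (p : ℤ) ∣ D :=
  ⟨fun h hpD ↦ not_lineUnramifiedAt_of_dvd hχ hp2 hD0 hsq hpD h,
    lineUnramifiedAt_of_not_dvd hp2 hχ⟩

end Ramification


/-! ### §6. The GV type of the line, and of the curve, from the kernel discriminant -/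

section GVType

variable (hΦ : IsRationalLine W p Φ) (hp2 : p ≠ 2) {D : ℤ} (hD0 : D ≠ 0) (hsq : Squarefree D)
  (hχ : ∀ σ : absoluteGaloisGroup ℚ, (∀ P ∈ Φ, σ • P = P) ↔ σ • geomSqrt (D : ℚ) = geomSqrt (D : ℚ))
  (hχ' : ∀ σ : absoluteGaloisGroup ℚ, (∀ P ∈ Φ, σ • P = -P) ↔ σ • geomSqrt (D : ℚ) = -geomSqrt (D : ℚ))

include hΦ hp2 hD0 hsq hχ hχ' in
/-- **The Greenberg–Vatsal type of the line from `D`.** The line is of GV type — (ramified at `p`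
∧ even) ∨ (unramified at `p` ∧ odd) — iff `(0 < D ↔ p ∣ D)`, i.e. iff `D ∈ p·ℤ_{>0} ∪ (ℤ_{<0} ∖ pℤ)`;
it is of co-type — (unramified ∧ even) ∨ (ramified ∧ odd) — iff `D ∈ (ℤ_{>0} ∖ pℤ) ∪ p·ℤ_{<0}`.
[folklore] -/
theorem gvType_iff : ((¬ LineUnramifiedAt W p Φ ∧ LineEven W p Φ) ∨
      (LineUnramifiedAt W p Φ ∧ LineOdd W p Φ)) ↔ (0 < D ↔ (p : ℤ) ∣ D) := by
  rw [lineUnramifiedAt_iff_not_dvd hp2 hD0 hχ hsq, lineEven_iff_pos hΦ hp2 hD0 hχ hχ',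
    lineOdd_iff_neg hΦ hp2 hD0 hχ hχ']
  constructor
  · rintro (⟨hr, hpos⟩ | ⟨hu, hneg⟩)
    · exact ⟨fun _ ↦ not_not.mp hr, fun _ ↦ hpos⟩
    · exact ⟨fun hpos ↦ absurd hpos (not_lt.mpr hneg.le), fun hdvd ↦ absurd hdvd hu⟩
  · intro h
    rcases lt_or_gt_of_ne hD0 with hneg | hpos
    · exact Or.inr ⟨fun hdvd ↦ absurd (h.mpr hdvd) (not_lt.mpr hneg.le), hneg⟩
    · exact Or.inl ⟨not_not.mpr (h.mp hpos), hpos⟩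

include hΦ hp2 hD0 hsq hχ hχ' in
/-- **A line whose kernel discriminant satisfies `(0 < D ↔ p ∣ D)` makes the curve of
Greenberg–Vatsal type (`GVPar W p`)** — no reduction hypothesis. [folklore] -/
theorem gvPar_of_iff (h : 0 < D ↔ (p : ℤ) ∣ D) : GVPar W p :=
  ⟨Φ, hΦ, (gvType_iff hΦ hp2 hD0 hsq hχ hχ').mpr h⟩

include hΦ hp2 hD0 hsq hχ hχ' in
/-- **At a good ORDINARY odd `p` (globally minimal model): `GVPar W p ↔ (0 < D ↔ p ∣ D)`** — the
type does not depend on the line (x1a's `gvType_iff_of_isRationalLine`). [folklore] -/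
theorem gvPar_iff_of_goodOrd [W.IsElliptic] [W.IsGloballyMinimal]
    (hgood : W.HasGoodReductionAtPrime p) (hord : ¬ (p : ℤ) ∣ W.frobeniusTrace p) :
    GVPar W p ↔ (0 < D ↔ (p : ℤ) ∣ D) := by
  refine ⟨fun hB ↦ ?_, gvPar_of_iff hΦ hp2 hD0 hsq hχ hχ'⟩
  by_contra h
  exact not_gvPar_of_isRationalLine hp2 hgood hord hΦ
    (fun hQ ↦ h ((gvType_iff hΦ hp2 hD0 hsq hχ hχ').mp hQ)) hB

include hΦ hp2 hD0 hsq hχ hχ' in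
/-- **At an odd MULTIPLICATIVE `p` (globally minimal model, granted the Tate-uniformisation facts
`hT`, `hT'`): `GVPar W p ↔ (0 < D ↔ p ∣ D)`** (lit-cgls session 9's
`X2.gvType_iff_of_isRationalLine_of_mult`).
[cite: SilvermanATAEC1994, Thm. V.5.3 and Cor. V.5.4] -/
theorem gvPar_iff_of_mult [W.IsElliptic] [W.IsGloballyMinimal]
    (hT : Silverman1994_thmV53_tateUniformisation.{0})
    (hT' : Silverman1994_thmV53_corV54_tateUniformisation.{0})
    (hmult : W.HasMultiplicativeReductionAtPrime p) : GVPar W p ↔ (0 < D ↔ (p : ℤ) ∣ D) := by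
  refine ⟨fun hB ↦ ?_, gvPar_of_iff hΦ hp2 hD0 hsq hχ hχ'⟩
  by_contra h
  exact X2.not_gvPar_of_isRationalLine_of_mult hT hT' hp2 hmult hΦ
    (fun hQ ↦ h ((gvType_iff hΦ hp2 hD0 hsq hχ hχ').mp hQ)) hB

end GVType

/-! ### §7. The twist by the kernel discriminant has a rational point of order `p` -/

/-- **Twisting by the kernel discriminant trivialises the line.** For a quadratic rational line
`Φ ≤ E[p]` with kernel discriminant `D` (property `hχ`) and ANY model `Wd` of the quadratic twist
`E^{(D)}` (`C • Wd = W.quadraticTwist D`): `E^{(D)}(ℚ)` has a point of order `p`. (Along the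
sign-equivariant identification `e : E^{(D)}[p] ≃ E[p]` — Silverman X.5.4, x1a's
`exists_signEquiv_of_twist` — the pull-back of a generator of `Φ` is fixed by every `σ ∈ Γ_ℚ`:
fixers of `√D` fix it, negators of `√D` negate twice; then Galois descent
`exists_addOrderOf_eq_of_forall_smul_eq`.) [cite: SilvermanAEC2009, X.5 Cor. 5.4] -/
theorem exists_addOrderOf_eq_of_twist (hΦ : IsRationalLine W p Φ) (hp2 : p ≠ 2)
    (hq : ∀ σ : absoluteGaloisGroup ℚ, ∀ P ∈ Φ, σ • P = P ∨ σ • P = -P) {D : ℤ} (hD0 : D ≠ 0)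
    (hχ : ∀ σ : absoluteGaloisGroup ℚ, (∀ P ∈ Φ, σ • P = P) ↔ σ • geomSqrt (D : ℚ) = geomSqrt (D : ℚ))
    {Wd : WeierstrassCurve ℚ} (C : VariableChange ℚ) (hC : C • Wd = W.quadraticTwist (D : ℚ)) :
    ∃ Q : Wd.toAffine.Point, addOrderOf Q = p := by
  have hp : p.Prime := Fact.out
  have hD0' : (D : ℚ) ≠ 0 := by exact_mod_cast hD0
  obtain ⟨e, hpos, hneg⟩ := exists_signEquiv_of_twist (W := W) (Wd := Wd) (p := p) hD0' C hC
  obtain ⟨P₀, hP₀, hP₀0⟩ := exists_ne_zero_mem hΦ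
  set T : geomTorsion Wd (p : ℤ) := e.symm P₀ with hT
  have heT : e T = P₀ := e.apply_symm_apply P₀
  -- `T` is `Γ_ℚ`-fixed
  have hfixT : ∀ σ : absoluteGaloisGroup ℚ, σ • T = T := by
    intro σ
    apply e.injective
    by_cases hσ : σ • geomSqrt (D : ℚ) = geomSqrt (D : ℚ)
    · rw [hpos σ hσ T, heT]
      exact (hχ σ).mpr hσ P₀ hP₀
    · rw [hneg σ hσ T, heT]
      have hσ' : σ • geomSqrt (D : ℚ) = -geomSqrt (D : ℚ) := (smul_geomSqrt_eq_or σ _).resolve_left hσ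
      rw [(forall_smul_eq_neg_iff hΦ hp2 hq hD0 hχ σ).mpr hσ' P₀ hP₀, neg_neg]
  have hfixT' : ∀ σ : absoluteGaloisGroup ℚ, σ • (T : Wd.geomPoints) = T := fun σ ↦ by
    rw [← AddSubgroup.torsionBy.coe_smul, hfixT σ]
  -- its order is `p`
  have hT0 : (T : Wd.geomPoints) ≠ 0 := by
    intro h0
    apply hP₀0
    rw [← heT, show T = 0 from Subtype.ext h0, map_zero]
  have hpT : p • (T : Wd.geomPoints) = 0 := by
    have h := (mem_torsionPoints_iff _ _ (T : Wd.geomPoints)).mp T.2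
    rwa [natCast_zsmul] at h
  have hordT : addOrderOf (T : Wd.geomPoints) = p := addOrderOf_eq_prime hpT hT0
  obtain ⟨Q, -, hQ⟩ := exists_addOrderOf_eq_of_forall_smul_eq Wd (T : Wd.geomPoints) hfixT'
  exact ⟨Q, hQ.trans hordT⟩

/-! ### §8. `p = 3`: every Eisenstein pair has a kernel discriminant -/

section Three

variable (W)

/-- **THE KERNEL DISCRIMINANT AT `p = 3` (classes X1@3 and X2@3, and any curve with reducible
`E[3]`).** If `E[3]` is reducible then there are a rational line `Φ ≤ E[3]` and a SQUAREFREE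
INTEGER `D ≠ 0` such that: `Γ_ℚ` acts on `Φ` through the quadratic character of `ℚ(√D)`; `Φ` is
even iff `D > 0`, odd iff `D < 0`, unramified at `3` iff `3 ∤ D`; EVERY model of the quadratic
twist `E^{(D)}` has a rational point of order `3`; and `D` is read off ANY non-zero `P ∈ Φ`: its
`x`-coordinate is a rational `x₀` and `D · s² = 4x₀³ + b₂x₀² + 2b₄x₀ + b₆` with `s ∈ ℚˣ`.
(No reduction hypothesis at `3`.) [folklore] -/
theorem exists_kernelDisc_three [W.IsElliptic] (hred : ¬ W.HasIrreducibleModPGaloisRep 3) :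
    ∃ (Φ : AddSubgroup (geomTorsion W ((3 : ℕ) : ℤ))) (D : ℤ), IsRationalLine W 3 Φ ∧ D ≠ 0 ∧
      Squarefree D ∧
      (∀ σ : absoluteGaloisGroup ℚ, (∀ P ∈ Φ, σ • P = P) ↔ σ • geomSqrt (D : ℚ) = geomSqrt (D : ℚ)) ∧
      (LineEven W 3 Φ ↔ 0 < D) ∧ (LineOdd W 3 Φ ↔ D < 0) ∧
      (LineUnramifiedAt W 3 Φ ↔ ¬ (3 : ℤ) ∣ D) ∧
      (∀ (Wd : WeierstrassCurve ℚ) (C : VariableChange ℚ), C • Wd = W.quadraticTwist (D : ℚ) →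
        ∃ Q : Wd.toAffine.Point, addOrderOf Q = 3) ∧
      (∀ P ∈ Φ, P ≠ 0 → ∃ (x₀ s : ℚ) (y : (AlgebraicClosure ℚ))
          (h : (W.baseChange (AlgebraicClosure ℚ)).toAffine.Nonsingular (algebraMap ℚ (AlgebraicClosure ℚ) x₀) y),
        (P : W.geomPoints) = Affine.Point.some (algebraMap ℚ (AlgebraicClosure ℚ) x₀) y h ∧ s ≠ 0 ∧
          (D : ℚ) * s ^ 2 = 4 * x₀ ^ 3 + W.b₂ * x₀ ^ 2 + 2 * W.b₄ * x₀ + W.b₆) := by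
  have h32 : (3 : ℕ) ≠ 2 := by decide
  obtain ⟨Φ, hΦ⟩ := exists_isRationalLine_of_not_irr W 3 hred
  have hq := isQuadratic_three hΦ
  obtain ⟨D, hD0, hsq, hχ⟩ := exists_kernelDisc hΦ h32 hq
  have hχ' := forall_smul_eq_neg_iff hΦ h32 hq hD0 hχ
  refine ⟨Φ, D, hΦ, hD0, hsq, hχ, lineEven_iff_pos hΦ h32 hD0 hχ hχ', lineOdd_iff_neg hΦ h32 hD0 hχ hχ',
    ?_, fun Wd C hC ↦ exists_addOrderOf_eq_of_twist hΦ h32 hq hD0 hχ C hC,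
    fun P hP hP0 ↦ exists_coord_of_mem hΦ h32 hq hD0 hχ hP hP0⟩
  have := lineUnramifiedAt_iff_not_dvd (W := W) (p := 3) (Φ := Φ) h32 hD0 hχ hsq
  simpa using this

/-- **GV type at a good ordinary `3` from the kernel discriminant**: for `E/ℚ` (globally minimal
model) with `E[3]` reducible and good ordinary reduction at `3`, there are a rational line `Φ`
and a squarefree `D ≠ 0` as in `exists_kernelDisc_three` (character, twist with rational
`3`-torsion, explicit formula) with **`GVPar W 3 ↔ (0 < D ↔ 3 ∣ D)`** — type B iff `D ∈ 3ℤ_{>0}`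
or `D ∈ ℤ_{<0} ∖ 3ℤ`; type A iff `D ∈ ℤ_{>0} ∖ 3ℤ` or `D ∈ 3ℤ_{<0}`. (Class X1 at `3`: `Anom W 3`
gives good ordinary.) [folklore] -/
theorem exists_kernelDisc_three_gvPar_iff_of_goodOrd [W.IsElliptic] [W.IsGloballyMinimal]
    (hred : ¬ W.HasIrreducibleModPGaloisRep 3) (hgood : W.HasGoodReductionAtPrime 3)
    (hord : ¬ ((3 : ℕ) : ℤ) ∣ W.frobeniusTrace 3) :
    ∃ (Φ : AddSubgroup (geomTorsion W ((3 : ℕ) : ℤ))) (D : ℤ), IsRationalLine W 3 Φ ∧ D ≠ 0 ∧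
      Squarefree D ∧
      (∀ σ : absoluteGaloisGroup ℚ, (∀ P ∈ Φ, σ • P = P) ↔ σ • geomSqrt (D : ℚ) = geomSqrt (D : ℚ)) ∧
      (∀ (Wd : WeierstrassCurve ℚ) (C : VariableChange ℚ), C • Wd = W.quadraticTwist (D : ℚ) →
        ∃ Q : Wd.toAffine.Point, addOrderOf Q = 3) ∧
      (∀ P ∈ Φ, P ≠ 0 → ∃ (x₀ s : ℚ) (y : (AlgebraicClosure ℚ))
          (h : (W.baseChange (AlgebraicClosure ℚ)).toAffine.Nonsingular (algebraMap ℚ (AlgebraicClosure ℚ) x₀) y),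
        (P : W.geomPoints) = Affine.Point.some (algebraMap ℚ (AlgebraicClosure ℚ) x₀) y h ∧ s ≠ 0 ∧
          (D : ℚ) * s ^ 2 = 4 * x₀ ^ 3 + W.b₂ * x₀ ^ 2 + 2 * W.b₄ * x₀ + W.b₆) ∧
      (GVPar W 3 ↔ (0 < D ↔ (3 : ℤ) ∣ D)) := by
  have h32 : (3 : ℕ) ≠ 2 := by decide
  obtain ⟨Φ, hΦ⟩ := exists_isRationalLine_of_not_irr W 3 hred
  have hq := isQuadratic_three hΦ
  obtain ⟨D, hD0, hsq, hχ⟩ := exists_kernelDisc hΦ h32 hq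
  have hχ' := forall_smul_eq_neg_iff hΦ h32 hq hD0 hχ
  refine ⟨Φ, D, hΦ, hD0, hsq, hχ, fun Wd C hC ↦ exists_addOrderOf_eq_of_twist hΦ h32 hq hD0 hχ C hC,
    fun P hP hP0 ↦ exists_coord_of_mem hΦ h32 hq hD0 hχ hP hP0, ?_⟩
  have := gvPar_iff_of_goodOrd hΦ h32 hD0 hsq hχ hχ' hgood hord
  simpa using this

/-- **GV type at a multiplicative `3` from the kernel discriminant** (class X2 at `3`; granted the
Tate-uniformisation facts `hT`, `hT'`): same as `exists_kernelDisc_three_gvPar_iff_of_goodOrd`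
with **`GVPar W 3 ↔ (0 < D ↔ 3 ∣ D)`**. [cite: SilvermanATAEC1994, Thm. V.5.3 and Cor. V.5.4] -/
theorem exists_kernelDisc_three_gvPar_iff_of_mult [W.IsElliptic] [W.IsGloballyMinimal]
    (hT : Silverman1994_thmV53_tateUniformisation.{0})
    (hT' : Silverman1994_thmV53_corV54_tateUniformisation.{0})
    (hred : ¬ W.HasIrreducibleModPGaloisRep 3) (hmult : W.HasMultiplicativeReductionAtPrime 3) :
    ∃ (Φ : AddSubgroup (geomTorsion W ((3 : ℕ) : ℤ))) (D : ℤ), IsRationalLine W 3 Φ ∧ D ≠ 0 ∧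
      Squarefree D ∧
      (∀ σ : absoluteGaloisGroup ℚ, (∀ P ∈ Φ, σ • P = P) ↔ σ • geomSqrt (D : ℚ) = geomSqrt (D : ℚ)) ∧
      (∀ (Wd : WeierstrassCurve ℚ) (C : VariableChange ℚ), C • Wd = W.quadraticTwist (D : ℚ) →
        ∃ Q : Wd.toAffine.Point, addOrderOf Q = 3) ∧
      (∀ P ∈ Φ, P ≠ 0 → ∃ (x₀ s : ℚ) (y : (AlgebraicClosure ℚ))
          (h : (W.baseChange (AlgebraicClosure ℚ)).toAffine.Nonsingular (algebraMap ℚ (AlgebraicClosure ℚ) x₀) y),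
        (P : W.geomPoints) = Affine.Point.some (algebraMap ℚ (AlgebraicClosure ℚ) x₀) y h ∧ s ≠ 0 ∧
          (D : ℚ) * s ^ 2 = 4 * x₀ ^ 3 + W.b₂ * x₀ ^ 2 + 2 * W.b₄ * x₀ + W.b₆) ∧
      (GVPar W 3 ↔ (0 < D ↔ (3 : ℤ) ∣ D)) := by
  have h32 : (3 : ℕ) ≠ 2 := by decide
  obtain ⟨Φ, hΦ⟩ := exists_isRationalLine_of_not_irr W 3 hred
  have hq := isQuadratic_three hΦ
  obtain ⟨D, hD0, hsq, hχ⟩ := exists_kernelDisc hΦ h32 hq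
  have hχ' := forall_smul_eq_neg_iff hΦ h32 hq hD0 hχ
  refine ⟨Φ, D, hΦ, hD0, hsq, hχ, fun Wd C hC ↦ exists_addOrderOf_eq_of_twist hΦ h32 hq hD0 hχ C hC,
    fun P hP hP0 ↦ exists_coord_of_mem hΦ h32 hq hD0 hχ hP hP0, ?_⟩
  have := gvPar_iff_of_mult hΦ h32 hD0 hsq hχ hχ' hT hT' hmult
  simpa using this

/-- **CLASS X1 at `p = 3`** (`ClassX1 W 3`: reducible, good, anomalous — hence ordinary): the
Greenberg–Vatsal parity type of the pair is decided by its kernel discriminant,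
`GVPar W 3 ↔ (0 < D ↔ 3 ∣ D)` (N1 / N1′ / N1″ of the CLASS-CLOSURE tables at `3`: type B = N1′
iff `D ∈ 3ℤ_{>0} ∪ (ℤ_{<0} ∖ 3ℤ)`), together with the twist / explicit-formula data of
`exists_kernelDisc_three_gvPar_iff_of_goodOrd`. Research route; no claim about BSD is made here.
[folklore] -/
theorem classX1_three_gvPar_iff [W.IsElliptic] [W.IsGloballyMinimal] (hX1 : ClassX1 W 3) :
    ∃ (Φ : AddSubgroup (geomTorsion W ((3 : ℕ) : ℤ))) (D : ℤ), IsRationalLine W 3 Φ ∧ D ≠ 0 ∧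
      Squarefree D ∧
      (∀ σ : absoluteGaloisGroup ℚ, (∀ P ∈ Φ, σ • P = P) ↔ σ • geomSqrt (D : ℚ) = geomSqrt (D : ℚ)) ∧
      (∀ (Wd : WeierstrassCurve ℚ) (C : VariableChange ℚ), C • Wd = W.quadraticTwist (D : ℚ) →
        ∃ Q : Wd.toAffine.Point, addOrderOf Q = 3) ∧
      (∀ P ∈ Φ, P ≠ 0 → ∃ (x₀ s : ℚ) (y : (AlgebraicClosure ℚ))
          (h : (W.baseChange (AlgebraicClosure ℚ)).toAffine.Nonsingular (algebraMap ℚ (AlgebraicClosure ℚ) x₀) y),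
        (P : W.geomPoints) = Affine.Point.some (algebraMap ℚ (AlgebraicClosure ℚ) x₀) y h ∧ s ≠ 0 ∧
          (D : ℚ) * s ^ 2 = 4 * x₀ ^ 3 + W.b₂ * x₀ ^ 2 + 2 * W.b₄ * x₀ + W.b₆) ∧
      (GVPar W 3 ↔ (0 < D ↔ (3 : ℤ) ∣ D)) :=
  exists_kernelDisc_three_gvPar_iff_of_goodOrd W hX1.2.1 (goodOrd_of_anom W 3 hX1.2.2.2.1).1
    (goodOrd_of_anom W 3 hX1.2.2.2.1).2

/-- **CLASS X2 at `p = 3`** (`ClassX2 W 3`: reducible, multiplicative; granted `hT`, `hT'`): the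
Greenberg–Vatsal parity type of the pair is decided by its kernel discriminant,
`GVPar W 3 ↔ (0 < D ↔ 3 ∣ D)` (O9 = X2 ∩ {r = 1} and N9 = X2 ∩ {r = 0} at `3`: the sub-cells
`CellA` / `Cell…GV` are the `D ∈ 3ℤ_{>0} ∪ (ℤ_{<0} ∖ 3ℤ)` ones), together with the twist /
explicit-formula data. Research route; no claim about BSD is made here.
[cite: SilvermanATAEC1994, Thm. V.5.3 and Cor. V.5.4] -/
theorem classX2_three_gvPar_iff [W.IsElliptic] [W.IsGloballyMinimal]
    (hT : Silverman1994_thmV53_tateUniformisation.{0})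
    (hT' : Silverman1994_thmV53_corV54_tateUniformisation.{0}) (hX2 : ClassX2 W 3) :
    ∃ (Φ : AddSubgroup (geomTorsion W ((3 : ℕ) : ℤ))) (D : ℤ), IsRationalLine W 3 Φ ∧ D ≠ 0 ∧
      Squarefree D ∧
      (∀ σ : absoluteGaloisGroup ℚ, (∀ P ∈ Φ, σ • P = P) ↔ σ • geomSqrt (D : ℚ) = geomSqrt (D : ℚ)) ∧
      (∀ (Wd : WeierstrassCurve ℚ) (C : VariableChange ℚ), C • Wd = W.quadraticTwist (D : ℚ) →
        ∃ Q : Wd.toAffine.Point, addOrderOf Q = 3) ∧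
      (∀ P ∈ Φ, P ≠ 0 → ∃ (x₀ s : ℚ) (y : (AlgebraicClosure ℚ))
          (h : (W.baseChange (AlgebraicClosure ℚ)).toAffine.Nonsingular (algebraMap ℚ (AlgebraicClosure ℚ) x₀) y),
        (P : W.geomPoints) = Affine.Point.some (algebraMap ℚ (AlgebraicClosure ℚ) x₀) y h ∧ s ≠ 0 ∧
          (D : ℚ) * s ^ 2 = 4 * x₀ ^ 3 + W.b₂ * x₀ ^ 2 + 2 * W.b₄ * x₀ + W.b₆) ∧
      (GVPar W 3 ↔ (0 < D ↔ (3 : ℤ) ∣ D)) :=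
  exists_kernelDisc_three_gvPar_iff_of_mult W hT hT' hX2.2.1 hX2.2.2

end Three

end KernelDisc

end Summit.BirchSwinnertonDyer.Rank1Residual

end
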